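import Summits.ValiantsHypothesis.ValiantsHypothesis.Theorems.FreeSubtorusOrbitDimensionBoundStubStableReductionAtomBlock
import Summits.ValiantsHypothesis.ValiantsHypothesis.Theorems.FreeSubtorusOrbitDimensionBoundStubStableReductionSplit

/-!
# `OrbitDimensionBound` (stmt-ValiantsHypothesis-16133), rung line `square_covering` — stub `stub_stableReduction`,
# part C₂: block-diagonal form of a SEMISIMPLE equivariant pencil

Helper file for stub 1 `stub_stableReduction` of `Cruxes/OrbitDimensionBound/Lines/square_covering.lean` (route
`FreeSubtorus`).  Case 2 of the socle dichotomy of part A: `ℂ^m = ⊕_{A ∈ T} A` is an internal direct sum of atoms of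
the pencil `B` and `ℂ^m = ⊕_A W(A)`.  Collecting bases (`DirectSum.IsInternal.collectedBasis`) gives a constant base
change `P B Q` which is BLOCK DIAGONAL with square blocks `blk A` (`dim A × dim A`), so that

* every block is affine and `∏_A det (blk A) = c · det B`, `c ≠ 0` (`Matrix.BlockTriangular.det_fintype`);
* every block is STABLE: `det (blk A) ≠ 0` and `¬ IsBlockDecomposable (blk A)` (part C₁, `not_isBlockDecomposable_of_atom`);
* every exact lift `B(γ·x) = g B(x) h⁻¹` of a diagonal substitution `γ`, conjugated into the new bases and cut into
  blocks `Y_{A A'}` (from `g`) and `X_{A A'}` (from `h`), satisfies the TWISTED INTERTWINING relations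
  `Y_{A A'} · (blk A')_e = γ^e · (blk A)_e · X_{A A'}` for every monomial `e`, and for every `A'` some `X_{A A'} ≠ 0`.

This is the input of part C₃ (twisted Schur ⇒ the lifts permute the isomorphism types of the blocks).

Helper mode (`--supports stmt-ValiantsHypothesis-16133 --as helper`).  Honest framing: [folklore] linear algebra toward
ONE registered stub (`stub_stableReduction`, M) of a dormant rung line whose load-bearing stub `stub_gradedPowerCount` is
OPEN; the crux `OrbitDimensionBound`, the route `FreeSubtorus` and VP ≠ VNP are OPEN and are not moved by this file.

## References (orientation only)
* A. D. King, Quart. J. Math. 45 (1994), §3.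
* [LandsbergRessayre2017] J. M. Landsberg, N. Ressayre, Differential Geom. Appl. 55 (2017), §3, §6.
-/

set_option linter.dupNamespace false

namespace Summit.ValiantsHypothesis.ValiantsHypothesis.Theorems.FreeSubtorusOrbitDimensionBound.SquareCovering.StableReduction

open Matrix MvPolynomial Module
open Literature.Computability.AlgebraicComplexity
open Summit.ValiantsHypothesis.ValiantsHypothesis.Theorems.FreeSubtorusConfusionCovering
open Summit.ValiantsHypothesis.ValiantsHypothesis.Theorems.FreeSubtorusOrbitDimensionBound.SignCovering.PerSummand

variable {σ : Type*} [Fintype σ] [DecidableEq σ] {m : ℕ}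

/-- **Block-diagonal form of a semisimple equivariant pencil** (see the module docstring). [folklore] -/
theorem exists_blockDiagonal_form (B : Matrix (Fin m) (Fin m) (MvPolynomial σ ℂ))
    (hBaff : ∀ i j, (B i j).totalDegree ≤ 1) (hdet : B.det ≠ 0)
    (T : Finset (Submodule ℂ (Fin m → ℂ)))
    (hT : ∀ A ∈ T, A ≠ ⊥ ∧
      finrank ℂ ↥(⨆ e : σ →₀ ℕ, A.map (Matrix.toLin' (B.map (coeff e)))) ≤ finrank ℂ A ∧
      ∀ A' : Submodule ℂ (Fin m → ℂ), A' ≤ A → A' ≠ ⊥ →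
        finrank ℂ ↥(⨆ e : σ →₀ ℕ, A'.map (Matrix.toLin' (B.map (coeff e)))) ≤ finrank ℂ A' → A' = A)
    (hVint : DirectSum.IsInternal fun A : T => (A : Submodule ℂ (Fin m → ℂ)))
    (hWint : DirectSum.IsInternal fun A : T =>
      ⨆ e : σ →₀ ℕ, (A : Submodule ℂ (Fin m → ℂ)).map (Matrix.toLin' (B.map (coeff e))))
    (D : Set (GL σ ℂ)) (hD : ∀ γ ∈ D, ∃ t : σ → ℂ, (γ : Matrix σ σ ℂ) = Matrix.diagonal t)
    (hlift : ∀ γ ∈ D, ∃ g h : GL (Fin m) ℂ, Matrix.linSubstEntries γ B =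
      (g : Matrix (Fin m) (Fin m) ℂ).map C * B * ((h⁻¹ : GL (Fin m) ℂ) : Matrix (Fin m) (Fin m) ℂ).map C) :
    ∃ blk : (A : T) → Matrix (Fin (finrank ℂ (A : Submodule ℂ (Fin m → ℂ))))
        (Fin (finrank ℂ (A : Submodule ℂ (Fin m → ℂ)))) (MvPolynomial σ ℂ),
      (∀ A i j, (blk A i j).totalDegree ≤ 1) ∧
      (∃ c : ℂ, c ≠ 0 ∧ ∏ A, (blk A).det = C c * B.det) ∧
      (∀ A, (blk A).det ≠ 0) ∧
      (∀ A, ¬ IsBlockDecomposable (blk A)) ∧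
      (∀ γ ∈ D, ∃ X Y : (A A' : T) → Matrix (Fin (finrank ℂ (A : Submodule ℂ (Fin m → ℂ))))
          (Fin (finrank ℂ (A' : Submodule ℂ (Fin m → ℂ)))) ℂ,
        (∀ (A A' : T) (e : σ →₀ ℕ), Y A A' * (blk A').map (coeff e) =
          (∏ p ∈ e.support, (γ : Matrix σ σ ℂ) p p ^ e p) • ((blk A).map (coeff e) * X A A')) ∧
        (∀ A' : T, ∃ A : T, X A A' ≠ 0)) := by
  classical
  -- notation
  set F : (σ →₀ ℕ) → (Fin m → ℂ) →ₗ[ℂ] (Fin m → ℂ) := fun e => Matrix.toLin' (B.map (coeff e)) with hF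
  have hFapp : ∀ e x, F e x = B.map (coeff e) *ᵥ x := fun e x => Matrix.toLin'_apply _ _
  -- semistability from `det B ≠ 0`
  have hss : ∀ V : Submodule ℂ (Fin m → ℂ), finrank ℂ V ≤ finrank ℂ ↥(⨆ e, V.map (F e)) := by
    intro V
    by_contra hlt
    refine hdet (det_eq_zero_of_subpencil B V (⨆ e, V.map (F e)) (fun e x hx => ?_) (not_le.1 hlt))
    exact Submodule.mem_iSup_of_mem e (Submodule.mem_map_of_mem hx)
  have hdim : ∀ A : T, finrank ℂ ↥(⨆ e, (A : Submodule ℂ (Fin m → ℂ)).map (F e)) =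
      finrank ℂ (A : Submodule ℂ (Fin m → ℂ)) := fun A => le_antisymm (hT A A.2).2.1 (hss _)
  have hdpos : ∀ A : T, 0 < finrank ℂ (A : Submodule ℂ (Fin m → ℂ)) := fun A => by
    rw [pos_iff_ne_zero, Ne, Submodule.finrank_eq_zero]; exact (hT A A.2).1
  -- bases
  let bV : ∀ A : T, Basis (Fin (finrank ℂ (A : Submodule ℂ (Fin m → ℂ)))) ℂ (A : Submodule ℂ (Fin m → ℂ)) :=
    fun A => Module.finBasis ℂ _
  let bW : ∀ A : T, Basis (Fin (finrank ℂ (A : Submodule ℂ (Fin m → ℂ)))) ℂ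
      ↥(⨆ e, (A : Submodule ℂ (Fin m → ℂ)).map (F e)) := fun A => Module.finBasisOfFinrankEq ℂ _ (hdim A)
  let cV := hVint.collectedBasis bV
  let cW := hWint.collectedBasis bW
  let ε : (Σ A : T, Fin (finrank ℂ (A : Submodule ℂ (Fin m → ℂ)))) ≃ Fin m := cV.indexEquiv (Pi.basisFun ℂ (Fin m))
  let bC : Basis (Fin m) ℂ (Fin m → ℂ) := cV.reindex ε
  let bR : Basis (Fin m) ℂ (Fin m → ℂ) := cW.reindex ε
  set std := Pi.basisFun ℂ (Fin m) with hstd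
  let P : GL (Fin m) ℂ := ⟨bR.toMatrix std, std.toMatrix bR, Module.Basis.toMatrix_mul_toMatrix_flip bR std,
    Module.Basis.toMatrix_mul_toMatrix_flip std bR⟩
  let Q : GL (Fin m) ℂ := ⟨std.toMatrix bC, bC.toMatrix std, Module.Basis.toMatrix_mul_toMatrix_flip std bC,
    Module.Basis.toMatrix_mul_toMatrix_flip bC std⟩
  set Bt : Matrix (Fin m) (Fin m) (MvPolynomial σ ℂ) :=
    (P : Matrix (Fin m) (Fin m) ℂ).map C * B * (Q : Matrix (Fin m) (Fin m) ℂ).map C with hBt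
  -- coefficient matrices of `Bt` in block coordinates
  have hmemW : ∀ (e : σ →₀ ℕ) (A : T) (b : Fin (finrank ℂ (A : Submodule ℂ (Fin m → ℂ)))),
      F e ((bV A b : (A : Submodule ℂ (Fin m → ℂ))) : Fin m → ℂ) ∈ ⨆ e, (A : Submodule ℂ (Fin m → ℂ)).map (F e) :=
    fun e A b => Submodule.mem_iSup_of_mem e (Submodule.mem_map_of_mem (bV A b).2)
  have hBt_coeff : ∀ (e : σ →₀ ℕ) (x y : Σ A : T, Fin (finrank ℂ (A : Submodule ℂ (Fin m → ℂ)))),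
      (Bt.map (coeff e)) (ε x) (ε y) = cW.repr (F e ((bV y.1 y.2 : (y.1 : Submodule ℂ (Fin m → ℂ))) : Fin m → ℂ)) x := by
    intro e x y
    rw [hBt, map_coeff_mul_map_C, map_coeff_map_C_mul]
    change (bR.toMatrix std * B.map (coeff e) * std.toMatrix bC) (ε x) (ε y) = _
    rw [toMatrix_mul_mul_toMatrix_apply, Module.Basis.repr_reindex_apply, Module.Basis.reindex_apply,
      Equiv.symm_apply_apply, Equiv.symm_apply_apply, hVint.collectedBasis_coe]
  have hBt_ne : ∀ (e : σ →₀ ℕ) (x y : Σ A : T, Fin (finrank ℂ (A : Submodule ℂ (Fin m → ℂ)))), x.1 ≠ y.1 →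
      (Bt.map (coeff e)) (ε x) (ε y) = 0 := by
    rintro e ⟨A, a⟩ ⟨A', b⟩ hne
    rw [hBt_coeff]
    exact hWint.collectedBasis_repr_of_mem_ne bW (Ne.symm hne) (hmemW e A' b)
  have hBt_eq : ∀ (e : σ →₀ ℕ) (A : T) (a b : Fin (finrank ℂ (A : Submodule ℂ (Fin m → ℂ)))),
      (Bt.map (coeff e)) (ε ⟨A, a⟩) (ε ⟨A, b⟩) =
        (bW A).repr ⟨F e ((bV A b : (A : Submodule ℂ (Fin m → ℂ))) : Fin m → ℂ), hmemW e A b⟩ a := by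
    intro e A a b
    rw [hBt_coeff]
    exact hWint.collectedBasis_repr_of_mem bW (hmemW e A b)
  have hBt_ne' : ∀ (x y : Σ A : T, Fin (finrank ℂ (A : Submodule ℂ (Fin m → ℂ)))), x.1 ≠ y.1 → Bt (ε x) (ε y) = 0 :=
    fun x y hne => apply_eq_zero_of_forall_map_coeff _ _ _ fun e => hBt_ne e x y hne
  -- determinant: `Bt` is block diagonal in the `Σ`-indexing
  have hPdet : (P : Matrix (Fin m) (Fin m) ℂ).det ≠ 0 := by
    simpa [Matrix.GeneralLinearGroup.val_det_apply] using (Matrix.GeneralLinearGroup.det P).ne_zero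
  have hQdet : (Q : Matrix (Fin m) (Fin m) ℂ).det ≠ 0 := by
    simpa [Matrix.GeneralLinearGroup.val_det_apply] using (Matrix.GeneralLinearGroup.det Q).ne_zero
  have hprod : ∏ A : T, (Bt.submatrix (fun a => ε ⟨A, a⟩) (fun b => ε ⟨A, b⟩)).det =
      C ((P : Matrix (Fin m) (Fin m) ℂ).det * (Q : Matrix (Fin m) (Fin m) ℂ).det) * B.det := by
    -- index the blocks by `Fin (card T)` (a linear order) and use `BlockTriangular.det_fintype`
    set eT := Fintype.equivFin T with heT
    have hNtri : (Bt.submatrix ε ε).BlockTriangular (fun x => eT x.1) := fun x y hxy =>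
      hBt_ne' x y fun h => by simp only [h, lt_self_iff_false] at hxy
    have hblk : ∀ k : Fin (Fintype.card T), ((Bt.submatrix ε ε).toSquareBlock (fun x => eT x.1) k).det =
        (Bt.submatrix (fun a => ε ⟨eT.symm k, a⟩) (fun b => ε ⟨eT.symm k, b⟩)).det := by
      intro k
      let σk : {x : Σ A : T, Fin (finrank ℂ (A : Submodule ℂ (Fin m → ℂ))) // eT x.1 = k} ≃
          Fin (finrank ℂ ((eT.symm k : T) : Submodule ℂ (Fin m → ℂ))) :=
        (Equiv.subtypeEquivRight (p := fun x : Σ A : T, Fin (finrank ℂ (A : Submodule ℂ (Fin m → ℂ))) => eT x.1 = k)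
            (fun x => Equiv.apply_eq_iff_eq_symm_apply eT)).trans
          (Equiv.sigmaSubtype (β := fun A : T => Fin (finrank ℂ (A : Submodule ℂ (Fin m → ℂ)))) (eT.symm k))
      rw [← Matrix.det_submatrix_equiv_self σk.symm]
      rfl
    rw [← det_map_C_mul_mul_map_C, ← hBt, ← Matrix.det_submatrix_equiv_self ε Bt, hNtri.det_fintype,
      ← eT.symm.prod_comp]
    exact Finset.prod_congr rfl fun k _ => (hblk k).symm
  have hdetBt : ∀ A : T, (Bt.submatrix (fun a => ε ⟨A, a⟩) (fun b => ε ⟨A, b⟩)).det ≠ 0 := by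
    have h0 : ∏ A : T, (Bt.submatrix (fun a => ε ⟨A, a⟩) (fun b => ε ⟨A, b⟩)).det ≠ 0 := by
      rw [hprod]
      exact mul_ne_zero (by rw [Ne, C_eq_zero]; exact mul_ne_zero hPdet hQdet) hdet
    exact fun A => (Finset.prod_ne_zero_iff.1 h0) A (Finset.mem_univ A)
  -- the restricted pencil in coordinates: `B_e (bV A b) = ∑_a (Bt_e)_{(A,a),(A,b)} • bW A a`
  have hcol : ∀ (e : σ →₀ ℕ) (A : T) (b : Fin (finrank ℂ (A : Submodule ℂ (Fin m → ℂ)))),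
      F e ((bV A b : (A : Submodule ℂ (Fin m → ℂ))) : Fin m → ℂ) =
        ∑ a, (Bt.map (coeff e)) (ε ⟨A, a⟩) (ε ⟨A, b⟩) •
          ((bW A a : ↥(⨆ e, (A : Submodule ℂ (Fin m → ℂ)).map (F e))) : Fin m → ℂ) := by
    intro e A b
    calc F e ((bV A b : (A : Submodule ℂ (Fin m → ℂ))) : Fin m → ℂ)
        = ((⟨F e ((bV A b : (A : Submodule ℂ (Fin m → ℂ))) : Fin m → ℂ), hmemW e A b⟩ :
            ↥(⨆ e, (A : Submodule ℂ (Fin m → ℂ)).map (F e))) : Fin m → ℂ) := rfl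
      _ = ((∑ a, (bW A).repr ⟨F e ((bV A b : (A : Submodule ℂ (Fin m → ℂ))) : Fin m → ℂ), hmemW e A b⟩ a • bW A a :
            ↥(⨆ e, (A : Submodule ℂ (Fin m → ℂ)).map (F e))) : Fin m → ℂ) := by rw [Module.Basis.sum_repr]
      _ = ∑ a, (Bt.map (coeff e)) (ε ⟨A, a⟩) (ε ⟨A, b⟩) •
          ((bW A a : ↥(⨆ e, (A : Submodule ℂ (Fin m → ℂ)).map (F e))) : Fin m → ℂ) := by
        rw [Submodule.coe_sum]
        exact Finset.sum_congr rfl fun a _ => by rw [Submodule.coe_smul, hBt_eq]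
  refine ⟨fun A => Bt.submatrix (fun a => ε ⟨A, a⟩) (fun b => ε ⟨A, b⟩),
    fun A i j => totalDegree_map_C_mul_mul_map_C_le _ _ hBaff _ _,
    ⟨_, mul_ne_zero hPdet hQdet, hprod⟩,
    hdetBt, fun A => ?_, fun γ hγ => ?_⟩
  · -- stability of the block of the atom `A`
    refine not_isBlockDecomposable_of_atom F (A : Submodule ℂ (Fin m → ℂ)) rfl (hT A A.2).2.2 _
      ((A : Submodule ℂ (Fin m → ℂ)).subtype ∘ₗ ((bV A).equivFun.symm : (Fin _ → ℂ) →ₗ[ℂ] _))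
      ((⨆ e, (A : Submodule ℂ (Fin m → ℂ)).map (F e)).subtype ∘ₗ ((bW A).equivFun.symm : (Fin _ → ℂ) →ₗ[ℂ] _))
      (Subtype.val_injective.comp (bV A).equivFun.symm.injective)
      (Subtype.val_injective.comp (bW A).equivFun.symm.injective)
      (fun c => Submodule.coe_mem _) fun e c => ?_
    simp only [LinearMap.coe_comp, Function.comp_apply, LinearEquiv.coe_coe, Submodule.coe_subtype,
      Module.Basis.equivFun_symm_apply, Submodule.coe_sum, Submodule.coe_smul, map_sum, map_smul, hcol,
      Finset.smul_sum, smul_smul]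
    rw [Finset.sum_comm]
    refine Finset.sum_congr rfl fun a _ => ?_
    rw [← Finset.sum_smul, Matrix.mulVec, dotProduct]
    refine congrArg (· • _) (Finset.sum_congr rfl fun b _ => ?_)
    rw [mul_comm]
    rfl
  · -- block form of the lift of `γ`
    obtain ⟨t, ht⟩ := hD γ hγ
    obtain ⟨g, h, hgh⟩ := hlift γ hγ
    have hliftt := linSubstEntries_baseChange_of_lift γ B g h P Q hgh
    rw [← hBt] at hliftt
    set G : GL (Fin m) ℂ := P * g * P⁻¹ with hG
    set H : GL (Fin m) ℂ := Q⁻¹ * h * Q with hH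
    have hprodt : ∀ e : σ →₀ ℕ, (∏ p ∈ e.support, (γ : Matrix σ σ ℂ) p p ^ e p) = ∏ p ∈ e.support, t p ^ e p :=
      fun e => Finset.prod_congr rfl fun p _ => by rw [ht, Matrix.diagonal_apply_eq]
    -- coefficientwise: `t^e Bt_e H = G Bt_e`
    have hcoeff : ∀ e : σ →₀ ℕ, (∏ p ∈ e.support, t p ^ e p) • Bt.map (coeff e) * (H : Matrix (Fin m) (Fin m) ℂ) =
        (G : Matrix (Fin m) (Fin m) ℂ) * Bt.map (coeff e) := by
      intro e
      have h1 := map_coeff_eq_of_lift γ t ht Bt (G : Matrix (Fin m) (Fin m) ℂ)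
        ((H⁻¹ : GL (Fin m) ℂ) : Matrix (Fin m) (Fin m) ℂ) hliftt e
      rw [h1, Matrix.mul_assoc, ← Units.val_mul, inv_mul_cancel, Units.val_one, Matrix.mul_one]
    refine ⟨fun A A' => Matrix.of fun a b => (H : Matrix (Fin m) (Fin m) ℂ) (ε ⟨A, a⟩) (ε ⟨A', b⟩),
      fun A A' => Matrix.of fun a b => (G : Matrix (Fin m) (Fin m) ℂ) (ε ⟨A, a⟩) (ε ⟨A', b⟩),
      fun A A' e => ?_, fun A' => ?_⟩
    · -- the twisted intertwining relation, read off `hcoeff e` at the entries `(ε⟨A,a⟩, ε⟨A',b⟩)`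
      ext a b
      have hL : (((∏ p ∈ e.support, t p ^ e p) • Bt.map (coeff e)) * (H : Matrix (Fin m) (Fin m) ℂ))
          (ε ⟨A, a⟩) (ε ⟨A', b⟩) = ∑ c, (∏ p ∈ e.support, t p ^ e p) * coeff e (Bt (ε ⟨A, a⟩) (ε ⟨A, c⟩)) *
            (H : Matrix (Fin m) (Fin m) ℂ) (ε ⟨A, c⟩) (ε ⟨A', b⟩) := by
        rw [Matrix.mul_apply, ← Equiv.sum_comp ε, Fintype.sum_sigma, Finset.sum_eq_single A]
        · simp only [Matrix.smul_apply, Matrix.map_apply, smul_eq_mul]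
        · intro A'' _ hne
          exact Finset.sum_eq_zero fun c _ => by
            rw [Matrix.smul_apply, hBt_ne e ⟨A, a⟩ ⟨A'', c⟩ (Ne.symm hne), smul_zero, zero_mul]
        · exact fun hA => absurd (Finset.mem_univ A) hA
      have hR : ((G : Matrix (Fin m) (Fin m) ℂ) * Bt.map (coeff e)) (ε ⟨A, a⟩) (ε ⟨A', b⟩) =
          ∑ c, (G : Matrix (Fin m) (Fin m) ℂ) (ε ⟨A, a⟩) (ε ⟨A', c⟩) * coeff e (Bt (ε ⟨A', c⟩) (ε ⟨A', b⟩)) := by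
        rw [Matrix.mul_apply, ← Equiv.sum_comp ε, Fintype.sum_sigma, Finset.sum_eq_single A']
        · simp only [Matrix.map_apply]
        · intro A'' _ hne
          exact Finset.sum_eq_zero fun c _ => by rw [hBt_ne e ⟨A'', c⟩ ⟨A', b⟩ hne, mul_zero]
        · exact fun hA => absurd (Finset.mem_univ A') hA
      have h2 := congrFun (congrFun (hcoeff e) (ε ⟨A, a⟩)) (ε ⟨A', b⟩)
      rw [hL, hR] at h2
      rw [hprodt e]
      simp only [Matrix.mul_apply, Matrix.smul_apply, Matrix.map_apply, Matrix.submatrix_apply, Matrix.of_apply,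
        smul_eq_mul, Finset.mul_sum]
      rw [← h2]
      exact Finset.sum_congr rfl fun c _ => by ring
    · -- some block of the column `A'` of `H` is non-zero, since `H` is invertible
      by_contra hall
      push Not at hall
      have hHdet : (H : Matrix (Fin m) (Fin m) ℂ).det ≠ 0 := by
        simpa [Matrix.GeneralLinearGroup.val_det_apply] using (Matrix.GeneralLinearGroup.det H).ne_zero
      refine hHdet (Matrix.det_eq_zero_of_column_eq_zero (ε ⟨A', ⟨0, hdpos A'⟩⟩) fun i => ?_)
      obtain ⟨⟨A, a⟩, rfl⟩ := ε.surjective i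
      have := congrFun (congrFun (hall A) a) ⟨0, hdpos A'⟩
      simpa only [Matrix.of_apply, Matrix.zero_apply] using this

end Summit.ValiantsHypothesis.ValiantsHypothesis.Theorems.FreeSubtorusOrbitDimensionBound.SquareCovering.StableReduction
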